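import Literature.MathematicalPhysics.QuantumFieldTheory.Balaban1983to89.T4InputCauchyRateSharp
import Literature.MathematicalPhysics.QuantumFieldTheory.Balaban1983to89.T4CauchySum

/-!
# Spine/NE5/ResonantProfile — row NE5 (node U3): the typed target `NE5` (ONE K-uniform constant) is STRICTLY STRONGER than what node
# U6 consumes; AT THE RESONANT THRESHOLD of the route's renewal budget the consumer shape `T4CauchySum.InjectedRate` is still served

Cell `pub-balaban-gaps` (YM blitz Y1, track G2), seat `ne5` (`prover-pub-balaban-gaps-ne5-g0-0`), triage sheet `HOME/ne/NE5.md` §5 row B1 / §6 T2.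
Imports `T4InputCauchyRateSharp` (the renewal recursion solved exactly) and `T4CauchySum` (node U6's consumer shape); modifies nothing.

WHAT IS RECORDED (a WEAKENING in the repair census, kernel-checked).  Node U6 consumes the injected discrepancies through
`T4CauchySum.InjectedRate C c θ inj := ∀ K j, j ≤ K → 0 ≤ inj K j ∧ inj K j ≤ C (K+1)^c θ^j` — a constant POLYNOMIAL IN THE RUN
LENGTH K is admissible (`T4CauchySum.summable_delta`), whereas the typed `T4OutputRate.NE5 EA EB W κ θ C₅` asks ONE constant for all
scales.  The route's recursive budget `T4InputCauchyRate.RecursiveRate EA EB W κ θ ω A b` has the threshold rate `(1 + b)ω`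
(`T4InputCauchyRateSharp`: off resonance NE5 holds AT `max θ ((1+b)ω)` with a uniform constant; AT RESONANCE `θ = (1 + b)ω` the exact
solution is `A(1 + k·b/(1+b))((1+b)ω)^k` — `boundedAtScale_resonance_of_recursiveRate` — and NO uniform constant exists,
`res_not_ne5_of_le`).  On the carriers of a K-step run every localization domain has creation step `≤ K`; there (§1) the resonant budget
gives NE5 AT the threshold with the K-LINEAR constant `A(1 + K·b/(1+b)) ≤ A(K+1)`, and (§2) the resonant profile
`(K, j) ↦ A(1 + K·b/(1+b))((1+b)ω)^j` IS an `InjectedRate A 1 ((1+b)ω)`.  So the sharpness of leaf L11 at the typed interface costs the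
CONSUMER nothing at the resonance point itself; strictly above the threshold the smallness remains necessary in substance (the exponent),
which this file does not touch.

HONEST FRAMING.  NE5 is a cell NEW ESTIMATE — NOT PRINTED (GAPS G-t4-U3-1), NOT PROVED; real arithmetic over abstract carriers; no leaf
instantiated on Bałaban's objects (0/12 unchanged); rung (B)+1 bookkeeping on a FIXED finite T⁴ — NOT the continuum limit by itself, NOT
infinite volume, NOT a mass gap, NOT Clay.  Spine PROVED 0/9.  HONEST DEPENDENCY: continuum YM on T⁴ ⇐ BetaPertH ∧ nine spine estimates
(0/9 proved); BetaPertH ⇐ (D1) ∧ (D4) ∧ CAP+tail.  0 sorry; axioms standard; 0 cite tags.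
-/

noncomputable section

namespace Summit.QuantumFields.BalabanUV.T4Continuum.Spine.NE5

open Literature.MathematicalPhysics.QuantumFieldTheory.Balaban1983to89
open Literature.MathematicalPhysics.QuantumFieldTheory.Balaban1983to89.T4OutputRate
open Literature.MathematicalPhysics.QuantumFieldTheory.Balaban1983to89.T4InputCauchyRate
open Literature.MathematicalPhysics.QuantumFieldTheory.Balaban1983to89.T4InputCauchyRateSharp
open Literature.MathematicalPhysics.QuantumFieldTheory.Balaban1983to89.T4CauchySum

/-! ## §1 NE5 at the resonant threshold on the carriers of a K-step run -/

section BoundedScale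

variable {C : Carriers} {EA : Functional C C.BgA} {EB : Functional C C.BgB} {W : Set (ℕ → ℝ)} {κ ω A b : ℝ}

/-- The resonant prefactor is monotone in the scale: `1 + j·b/(1+b) ≤ 1 + K·b/(1+b)` for `j ≤ K`, `b ≥ 0`. [folklore] -/
theorem resonant_prefactor_mono (hb : 0 ≤ b) {j K : ℕ} (hjK : j ≤ K) :
    1 + (j : ℝ) * b / (1 + b) ≤ 1 + (K : ℝ) * b / (1 + b) := by
  have h1 : 0 ≤ b / (1 + b) := div_nonneg hb (by linarith)
  have h2 : (j : ℝ) ≤ K := Nat.cast_le.mpr hjK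
  have : (j : ℝ) * b / (1 + b) ≤ (K : ℝ) * b / (1 + b) := by
    rw [mul_div_assoc, mul_div_assoc]; exact mul_le_mul_of_nonneg_right h2 h1
  linarith

/-- The resonant prefactor is at most linear: `1 + K·b/(1+b) ≤ K + 1` (`b/(1+b) ≤ 1`). [folklore] -/
theorem resonant_prefactor_le_succ (hb : 0 ≤ b) (K : ℕ) : 1 + (K : ℝ) * b / (1 + b) ≤ (K : ℝ) + 1 := by
  have h1 : b / (1 + b) ≤ 1 := (div_le_one (by linarith)).mpr (by linarith)
  have hK : (0 : ℝ) ≤ K := Nat.cast_nonneg K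
  have : (K : ℝ) * b / (1 + b) ≤ K := by
    rw [mul_div_assoc]; exact mul_le_of_le_one_right hK h1
  linarith

/-- **NE5 AT THE RESONANT THRESHOLD, K-LINEAR CONSTANT.**  If every localization domain of the carriers has creation step `≤ K` (the
carriers of a K-step run) and the recursive budget holds AT RESONANCE (input rate `(1 + b)ω`), then NE5 holds at the threshold rate
`(1 + b)ω` with constant `A(1 + K·b/(1+b))` — by `boundedAtScale_resonance_of_recursiveRate` scale by scale and monotonicity of the
prefactor; scales above `K` are empty. [folklore] -/
theorem ne5_resonance_of_boundedScale {K : ℕ} (hK : ∀ X : C.Dom, C.scale X ≤ K) (hA : 0 ≤ A) (hb : 0 ≤ b) (hω : 0 ≤ ω)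
    (h : RecursiveRate EA EB W κ ((1 + b) * ω) ω A b) :
    NE5 EA EB W κ ((1 + b) * ω) (A * (1 + K * b / (1 + b))) := by
  rw [ne5_iff_boundedAtScale]
  intro j g hg U X hX
  have hjK : j ≤ K := hX ▸ hK X
  have hres := boundedAtScale_resonance_of_recursiveRate hA hb hω h j
  have hmono : A * (1 + j * b / (1 + b)) * ((1 + b) * ω) ^ j ≤ A * (1 + K * b / (1 + b)) * ((1 + b) * ω) ^ j :=
    mul_le_mul_of_nonneg_right (mul_le_mul_of_nonneg_left (resonant_prefactor_mono hb hjK) hA)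
      (pow_nonneg (mul_nonneg (by linarith) hω) j)
  exact boundedAtScale_mono hres hmono g hg U X hX

/-- … hence with the simpler K-LINEAR constant `A·(K + 1)`. [folklore] -/
theorem ne5_resonance_linear {K : ℕ} (hK : ∀ X : C.Dom, C.scale X ≤ K) (hA : 0 ≤ A) (hb : 0 ≤ b) (hω : 0 ≤ ω)
    (h : RecursiveRate EA EB W κ ((1 + b) * ω) ω A b) : NE5 EA EB W κ ((1 + b) * ω) (A * ((K : ℝ) + 1)) :=
  ne5_mono_const (ne5_resonance_of_boundedScale hK hA hb hω h) (mul_nonneg (by linarith) hω)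
    (mul_le_mul_of_nonneg_left (resonant_prefactor_le_succ hb K) hA)

end BoundedScale

/-! ## §2 The resonant profile is an `InjectedRate` (node U6's consumer shape, exponent `c = 1`) -/

section Consumer

/-- **THE RESONANT PROFILE IS CONSUMER-ADMISSIBLE**: `(K, j) ↦ A(1 + K·b/(1+b))·((1+b)ω)^j` satisfies
`T4CauchySum.InjectedRate A 1 ((1+b)ω)` (`0 ≤ A, b, ω`): the K-linear growth of the resonant constant is exactly the polynomial allowance
of node U6 (through which asymptotic freedom enters anyway, `T4CauchySum` §4). [folklore] -/
theorem injectedRate_resonantProfile {A b ω : ℝ} (hA : 0 ≤ A) (hb : 0 ≤ b) (hω : 0 ≤ ω) :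
    InjectedRate A 1 ((1 + b) * ω) (fun K j => A * (1 + K * b / (1 + b)) * ((1 + b) * ω) ^ j) := by
  intro K j _
  have hr : 0 ≤ ((1 + b) * ω) ^ j := pow_nonneg (mul_nonneg (by linarith) hω) j
  have hpre : 0 ≤ 1 + (K : ℝ) * b / (1 + b) := by
    have : 0 ≤ (K : ℝ) * b / (1 + b) := div_nonneg (mul_nonneg (Nat.cast_nonneg K) hb) (by linarith)
    linarith
  refine ⟨mul_nonneg (mul_nonneg hA hpre) hr, ?_⟩
  rw [pow_one]
  exact mul_le_mul_of_nonneg_right (mul_le_mul_of_nonneg_left (resonant_prefactor_le_succ hb K) hA) hr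

/-- … and therefore node U6's transported total is SUMMABLE at resonance as soon as the threshold rate and the irrelevance contraction
are below one (`T4CauchySum.summable_delta` BY NAME). [folklore] -/
theorem summable_delta_resonantProfile {A b ω E ρ : ℝ} (hA : 0 ≤ A) (hb : 0 ≤ b) (hω : 0 ≤ ω) (hr1 : (1 + b) * ω < 1)
    (hE : 0 ≤ E) (hρ : 0 ≤ ρ) (hρ1 : ρ < 1) :
    Summable (delta E ρ (fun K j => A * (1 + K * b / (1 + b)) * ((1 + b) * ω) ^ j)) :=
  summable_delta (injectedRate_resonantProfile hA hb hω) hE (mul_nonneg (by linarith) hω) hr1 hρ hρ1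

end Consumer

end Summit.QuantumFields.BalabanUV.T4Continuum.Spine.NE5
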